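import Literature.Computability.Cryptography.ZhandryOracle
import Literature.Computability.QuantumComplexity.RazTalBlocks
import HarnessLib

/-!
# The `BQP^O` Simon machine for the level encoding, I: strings and wire layout

Third file of the machine behind the hypothesis `SimonLevelMachine` of
`Literature/Barriers/QuantumAdvantage/PPolyOraclesThm76Simon.lean` (Simon's algorithm run with XOR
oracle gates on the level encoding `ancStr`/`qryStr` of `Cryptography/ZhandryOracle.lean`). An
oracle gate reads its query string off a list of DISTINCT wires; the strings of the encoding are
spelled by constant wires (set to `1`, or left at `0`) together with the query register `y` and a
COPY `y'` of it (the pairing `boolPair` doubles every bit of its first component, so each `y_t` is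
needed twice). The layout is chosen so that every query reads its wires in INCREASING order, which
makes distinctness a matter of monotonicity. This file fixes the layout arithmetic and proves that
the wire lists spell the intended strings:

* `qryStr_eq_bits`, `ancStr_eq_bits` — the strings of the encoding as explicit bit lists;
* the layout at input length `n` with block-length bound `B'` and `NB` blocks: the low constant
  wires `loW p` (`p ≤ 2n+2`: `1^{2n} 0 1 1`), the announcement answers `cW i` (`i ≤ B'`), block
  `β`'s interleaved pair register `pairW β t r` (`y_t` at `r = 0`, its copy at `r = 1`) and value
  register `valW β t`, the top zero wire `topZ` and the high constant-`1` wires `hiW s` (`s ≤ B'`),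
  `Wtot`; order and injectivity lemmas;
* `qryWires`, `ancWires` — the wire lists of the value queries and of the announcement queries —
  increasing (`pairwise_lt_qryWires`, `pairwise_lt_ancWires`), avoiding their answer wires, and
  reading `qryStr n y i'` / `ancStr n i` off a basis label with the constants set and `y' = y`
  (`map_qryWires`, `map_ancWires`).

## References

* D. R. Simon, SIAM J. Comput. 26 (1997), §3.1 [Simon1997].
* S. Aaronson, L. Chen, CCC 2017, Thm. 7.6 (proof, p. 30: the oracle encodes `⟨x, i⟩ ↦ f_n(x)_i`)
  [AaronsonChen2017].
* M. A. Nielsen, I. L. Chuang, CUP 2010, §6.1.1 (query registers) [NielsenChuang2010].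
-/

namespace Literature.Computability.QuantumComplexity

open _root_.Computability Complexity Cryptography

namespace SimonOracle

/-! ### The strings of the encoding as bit lists -/

/-- Doubling every bit of a block of `1`s. [folklore] -/
private theorem flatMap_pair_replicate_true (k : ℕ) :
    ((List.replicate k true).flatMap fun b => [b, b]) = List.replicate (2 * k) true := by
  induction k with
  | zero => rfl
  | succ k ih =>
    rw [List.replicate_succ, List.flatMap_cons, ih, show 2 * (k + 1) = 1 + 1 + 2 * k by ring,
      List.replicate_add, List.replicate_add]
    rfl

/-- `1ⁿ` in unary is `n` ones. [folklore] -/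
private theorem unaryEncodeNat_eq_replicate' (n : ℕ) : unaryEncodeNat n = List.replicate n true := by
  induction n with
  | zero => rfl
  | succ n ih => rw [List.replicate_succ, ← ih]; rfl

/-- **The value-query string as bits**: `qryStr n y i' = 1^{2n} 0 1 1 (y₁y₁⋯y_jy_j) 0 1 1^{i'}`.
[cite: AaronsonChen2017, Thm. 7.6 (proof, p. 30)] -/
theorem qryStr_eq_bits (n : ℕ) (y : List Bool) (i' : ℕ) :
    qryStr n y i' = List.replicate (2 * n) true ++ [false, true, true] ++ (y.flatMap fun b => [b, b]) ++
      [false, true] ++ List.replicate i' true := by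
  rw [qryStr, boolPair, boolPair, unaryEncodeNat_eq_replicate', unaryEncodeNat_eq_replicate',
    flatMap_pair_replicate_true]
  simp [List.append_assoc]

/-- **The announcement string as bits**: `ancStr n i = 1^{2n} 0 1 0 1^{i}`.
[cite: AaronsonChen2017, Thm. 7.6 (proof, p. 30)] -/
theorem ancStr_eq_bits (n i : ℕ) :
    ancStr n i = List.replicate (2 * n) true ++ [false, true, false] ++ List.replicate i true := by
  rw [ancStr, boolPair, unaryEncodeNat_eq_replicate', unaryEncodeNat_eq_replicate', flatMap_pair_replicate_true]
  simp [List.append_assoc]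

/-! ### The layout -/

section Layout

variable (n B' NB : ℕ)

/-- Low constant wire `p ≤ 2n + 2`, right after the input: `1^{2n} 0 1 1`. [folklore] -/
def loW (p : ℕ) : ℕ := n + p

/-- The constant carried by low wire `p`: `0` at `p = 2n`, `1` elsewhere. [folklore] -/
def loBit (p : ℕ) : Bool := decide (p ≠ 2 * n)

/-- The answer wire of announcement `i ≤ B'`. [folklore] -/
def cW (i : ℕ) : ℕ := 3 * n + 3 + i

/-- The first register wire. [folklore] -/
def baseR : ℕ := 3 * n + 4 + B'

/-- The first wire of block `β` (stride `3 B'`: `2 B'` for the interleaved pair register, `B'` for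
the value register). [folklore] -/
def blkW (β : ℕ) : ℕ := baseR n B' + β * (3 * B')

/-- Pair-register wire: block `β`, position `t < B'`, `r = 0` for `y_t`, `r = 1` for its copy `y'_t`. [folklore] -/
def pairW (β t r : ℕ) : ℕ := blkW n B' β + (2 * t + r)

/-- Value-register wire: block `β`, bit `t < B'`. [folklore] -/
def valW (β t : ℕ) : ℕ := blkW n B' β + (2 * B' + t)

/-- The top zero wire, above all blocks. [folklore] -/
def topZ : ℕ := blkW n B' NB

/-- High constant-`1` wire `s ≤ B'`. [folklore] -/
def hiW (s : ℕ) : ℕ := topZ n B' NB + 1 + s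

/-- The number of wires. [folklore] -/
def Wtot : ℕ := topZ n B' NB + 2 + B'

variable {n B' NB}

/-- The stride arithmetic of a block: offsets below `3 B'` determine block and offset. [folklore] -/
theorem blkW_add_inj {β m β' m' : ℕ} (hm : m < 3 * B') (hm' : m' < 3 * B')
    (h : blkW n B' β + m = blkW n B' β' + m') : β = β' ∧ m = m' := by
  unfold blkW at h
  have h1 : β * (3 * B') + m = β' * (3 * B') + m' := by omega
  have hβ : β = β' := by
    by_contra hne
    rcases Nat.lt_or_gt_of_ne hne with hlt | hlt
    · have : (β + 1) * (3 * B') ≤ β' * (3 * B') := Nat.mul_le_mul_right _ hlt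
      nlinarith
    · have : (β' + 1) * (3 * B') ≤ β * (3 * B') := Nat.mul_le_mul_right _ hlt
      nlinarith
  subst hβ
  exact ⟨rfl, by omega⟩

/-- Wires of block `β` lie below the start of block `β + 1`, hence below `topZ` for `β < NB`. [folklore] -/
theorem blkW_add_lt_topZ {β m : ℕ} (hβ : β < NB) (hm : m < 3 * B') : blkW n B' β + m < topZ n B' NB := by
  unfold topZ blkW
  have : (β + 1) * (3 * B') ≤ NB * (3 * B') := Nat.mul_le_mul_right _ hβ
  nlinarith

/-- **Pair wires are injective in `(β, t, r)`.** [folklore] -/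
theorem pairW_inj {β t r β' t' r' : ℕ} (ht : t < B') (ht' : t' < B') (hr : r < 2) (hr' : r' < 2)
    (h : pairW n B' β t r = pairW n B' β' t' r') : β = β' ∧ t = t' ∧ r = r' := by
  obtain ⟨h1, h2⟩ := blkW_add_inj (by omega) (by omega) h
  exact ⟨h1, by omega, by omega⟩

/-- **Value wires are injective in `(β, t)`.** [folklore] -/
theorem valW_inj {β t β' t' : ℕ} (ht : t < B') (ht' : t' < B') (h : valW n B' β t = valW n B' β' t') :
    β = β' ∧ t = t' := by
  obtain ⟨h1, h2⟩ := blkW_add_inj (by omega) (by omega) h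
  exact ⟨h1, by omega⟩

/-- A pair wire is not a value wire. [folklore] -/
theorem pairW_ne_valW {β t r β' t' : ℕ} (ht : t < B') (hr : r < 2) (ht' : t' < B') :
    pairW n B' β t r ≠ valW n B' β' t' := fun h => by
  obtain ⟨-, h2⟩ := blkW_add_inj (by omega) (by omega) h
  omega

/-- Low wires lie below the announcement wires. [folklore] -/
theorem loW_lt_cW {p : ℕ} (hp : p ≤ 2 * n + 2) (i : ℕ) : loW n p < cW n i := by unfold loW cW; omega

/-- Announcement wires lie below the blocks. [folklore] -/
theorem cW_lt_blkW {i : ℕ} (hi : i ≤ B') (β : ℕ) : cW n i < blkW n B' β := by unfold cW blkW baseR; nlinarith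

/-- Pair wires lie below `topZ`. [folklore] -/
theorem pairW_lt_topZ {β t r : ℕ} (hβ : β < NB) (ht : t < B') (hr : r < 2) : pairW n B' β t r < topZ n B' NB :=
  blkW_add_lt_topZ hβ (by omega)

/-- Value wires lie below `topZ`. [folklore] -/
theorem valW_lt_topZ {β t : ℕ} (hβ : β < NB) (ht : t < B') : valW n B' β t < topZ n B' NB :=
  blkW_add_lt_topZ hβ (by omega)

/-- High wires lie below `Wtot`. [folklore] -/
theorem hiW_lt_Wtot {s : ℕ} (hs : s ≤ B') : hiW n B' NB s < Wtot n B' NB := by unfold hiW Wtot; omega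

/-- `topZ < hiW s`. [folklore] -/
theorem topZ_lt_hiW (s : ℕ) : topZ n B' NB < hiW n B' NB s := by unfold hiW; omega

end Layout

/-! ### The wire lists of the queries -/

section Wires

variable (n B' NB : ℕ)

/-- **The wires spelling `qryStr n y i'`** for block `β` of block length `j`: the low constants
`1^{2n} 0 1 1`, the interleaved pairs `y_0 y'_0 ⋯ y_{j-1} y'_{j-1}`, the top zero and the first
high `1`, then `1^{i'}` — in increasing order. [cite: AaronsonChen2017, Thm. 7.6 (proof, p. 30)] -/
def qryWires (β j i' : ℕ) : List ℕ :=
  (List.range (2 * n + 3)).map (loW n) ++ (List.range (2 * j)).map (fun m => blkW n B' β + m) ++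
    [topZ n B' NB, hiW n B' NB 0] ++ (List.range i').map (fun s => hiW n B' NB (1 + s))

/-- **The wires spelling `ancStr n i`**: the low constants `1^{2n} 0 1`, the top zero, `1^{i}`. [cite: AaronsonChen2017, Thm. 7.6 (proof, p. 30)] -/
def ancWires (i : ℕ) : List ℕ :=
  (List.range (2 * n + 2)).map (loW n) ++ [topZ n B' NB] ++ (List.range i).map (fun s => hiW n B' NB (1 + s))

variable {n B' NB}

/-- A mapped range along a strictly increasing function is increasing. [folklore] -/
theorem pairwise_lt_map_range (k : ℕ) (f : ℕ → ℕ) (hf : ∀ a b, a < b → f a < f b) :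
    ((List.range k).map f).Pairwise (· < ·) :=
  List.pairwise_map.2 (List.pairwise_lt_range.imp fun h => hf _ _ h)

/-- **The value-query wires are increasing** (`β < NB`, `j ≤ B'`). [folklore] -/
theorem pairwise_lt_qryWires {β j i' : ℕ} (hβ : β < NB) (hj : j ≤ B') :
    (qryWires n B' NB β j i').Pairwise (· < ·) := by
  unfold qryWires
  rw [List.pairwise_append, List.pairwise_append, List.pairwise_append]
  refine ⟨⟨⟨pairwise_lt_map_range _ _ fun a b h => by unfold loW; omega,
    pairwise_lt_map_range _ _ fun a b h => by omega, ?_⟩, ?_, ?_⟩, pairwise_lt_map_range _ _ fun a b h => by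
      unfold hiW; omega, ?_⟩
  · simp only [List.mem_map, List.mem_range]
    rintro _ ⟨p, hp, rfl⟩ _ ⟨m, hm, rfl⟩
    have h1 := loW_lt_cW (n := n) (p := p) (by omega) 0
    have h2 := cW_lt_blkW (n := n) (B' := B') (i := 0) (Nat.zero_le _) β
    omega
  · exact List.pairwise_pair.2 (topZ_lt_hiW 0)
  · simp only [List.mem_append, List.mem_map, List.mem_range, List.mem_cons, List.not_mem_nil, or_false]
    rintro a (⟨p, hp, rfl⟩ | ⟨m, hm, rfl⟩) b hb
    · have h1 := loW_lt_cW (n := n) (p := p) (by omega) 0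
      have h2 := cW_lt_blkW (n := n) (B' := B') (i := 0) (Nat.zero_le _) NB
      have h3 := topZ_lt_hiW (n := n) (B' := B') (NB := NB) 0
      rcases hb with rfl | rfl <;> unfold topZ at * <;> omega
    · have h1 := blkW_add_lt_topZ (n := n) (B' := B') hβ (m := m) (by omega)
      have h3 := topZ_lt_hiW (n := n) (B' := B') (NB := NB) 0
      rcases hb with rfl | rfl <;> omega
  · simp only [List.mem_append, List.mem_map, List.mem_range, List.mem_cons, List.not_mem_nil, or_false]
    rintro a ((⟨p, hp, rfl⟩ | ⟨m, hm, rfl⟩) | hb) _ ⟨s, hs, rfl⟩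
    · have h1 := loW_lt_cW (n := n) (p := p) (by omega) 0
      have h2 := cW_lt_blkW (n := n) (B' := B') (i := 0) (Nat.zero_le _) NB
      have h3 := topZ_lt_hiW (n := n) (B' := B') (NB := NB) (1 + s)
      unfold topZ at *; omega
    · have h1 := blkW_add_lt_topZ (n := n) (B' := B') hβ (m := m) (by omega)
      have h3 := topZ_lt_hiW (n := n) (B' := B') (NB := NB) (1 + s)
      omega
    · rcases hb with rfl | rfl <;> unfold hiW <;> omega

/-- **The announcement wires are increasing.** [folklore] -/
theorem pairwise_lt_ancWires {i : ℕ} : (ancWires n B' NB i).Pairwise (· < ·) := by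
  unfold ancWires
  rw [List.pairwise_append, List.pairwise_append]
  refine ⟨⟨pairwise_lt_map_range _ _ fun a b h => by unfold loW; omega, List.pairwise_singleton _ _, ?_⟩,
    pairwise_lt_map_range _ _ fun a b h => by unfold hiW; omega, ?_⟩
  · simp only [List.mem_map, List.mem_range, List.mem_singleton]
    rintro _ ⟨p, hp, rfl⟩ _ rfl
    have h1 := loW_lt_cW (n := n) (p := p) (by omega) 0
    have h2 := cW_lt_blkW (n := n) (B' := B') (i := 0) (Nat.zero_le _) NB
    unfold topZ; omega
  · simp only [List.mem_append, List.mem_map, List.mem_range, List.mem_singleton]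
    rintro a (⟨p, hp, rfl⟩ | rfl) _ ⟨s, hs, rfl⟩
    · have h1 := loW_lt_cW (n := n) (p := p) (by omega) 0
      have h2 := cW_lt_blkW (n := n) (B' := B') (i := 0) (Nat.zero_le _) NB
      have h3 := topZ_lt_hiW (n := n) (B' := B') (NB := NB) (1 + s)
      unfold topZ at *; omega
    · exact topZ_lt_hiW _

/-- Every value-query wire is below `Wtot` (`i' < B'`). [folklore] -/
theorem lt_Wtot_of_mem_qryWires {β j i' a : ℕ} (hβ : β < NB) (hj : j ≤ B') (hi' : i' ≤ B')
    (ha : a ∈ qryWires n B' NB β j i') : a < Wtot n B' NB := by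
  unfold qryWires at ha
  simp only [List.mem_append, List.mem_map, List.mem_range, List.mem_cons, List.not_mem_nil, or_false] at ha
  have hW : topZ n B' NB + 2 + B' = Wtot n B' NB := rfl
  rcases ha with ((⟨p, hp, rfl⟩ | ⟨m, hm, rfl⟩) | (rfl | rfl)) | ⟨s, hs, rfl⟩
  · have h1 := loW_lt_cW (n := n) (p := p) (by omega) 0
    have h2 := cW_lt_blkW (n := n) (B' := B') (i := 0) (Nat.zero_le _) NB
    unfold topZ at hW; omega
  · have h1 := blkW_add_lt_topZ (n := n) (B' := B') hβ (m := m) (by omega); omega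
  · omega
  · unfold hiW; omega
  · unfold hiW; omega

/-- Every announcement wire is below `Wtot` (`i ≤ B'`). [folklore] -/
theorem lt_Wtot_of_mem_ancWires {i a : ℕ} (hi : i ≤ B') (ha : a ∈ ancWires n B' NB i) : a < Wtot n B' NB := by
  unfold ancWires at ha
  simp only [List.mem_append, List.mem_map, List.mem_range, List.mem_singleton] at ha
  have hW : topZ n B' NB + 2 + B' = Wtot n B' NB := rfl
  rcases ha with (⟨p, hp, rfl⟩ | rfl) | ⟨s, hs, rfl⟩
  · have h1 := loW_lt_cW (n := n) (p := p) (by omega) 0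
    have h2 := cW_lt_blkW (n := n) (B' := B') (i := 0) (Nat.zero_le _) NB
    unfold topZ at hW; omega
  · omega
  · unfold hiW; omega

/-- **The value wire of a query is not among its query wires** (`i' < B'`). [folklore] -/
theorem valW_not_mem_qryWires {β j i' : ℕ} (hβ : β < NB) (hj : j ≤ B') (hi' : i' < B') :
    valW n B' β i' ∉ qryWires n B' NB β j i' := by
  unfold qryWires
  simp only [List.mem_append, List.mem_map, List.mem_range, List.mem_cons, List.not_mem_nil, or_false, not_or,
    not_exists, not_and]
  refine ⟨⟨⟨fun p hp h => ?_, fun m hm h => ?_⟩, fun h => ?_, fun h => ?_⟩, fun s hs h => ?_⟩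
  · have h1 := loW_lt_cW (n := n) (p := p) (by omega) 0
    have h2 := cW_lt_blkW (n := n) (B' := B') (i := 0) (Nat.zero_le _) β
    unfold valW at h; omega
  · unfold valW at h; omega
  · exact absurd h (valW_lt_topZ hβ hi').ne
  · have := valW_lt_topZ (n := n) hβ hi'; unfold hiW at h; omega
  · have := valW_lt_topZ (n := n) hβ hi'; unfold hiW at h; omega

/-- **The answer wire of an announcement is not among its query wires.** [folklore] -/
theorem cW_not_mem_ancWires {i i₀ : ℕ} (hi₀ : i₀ ≤ B') : cW n i₀ ∉ ancWires n B' NB i := by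
  unfold ancWires
  simp only [List.mem_append, List.mem_map, List.mem_range, List.mem_singleton, not_or, not_exists, not_and]
  refine ⟨⟨fun p hp h => ?_, fun h => ?_⟩, fun s hs h => ?_⟩
  · have := loW_lt_cW (n := n) (p := p) (by omega) i₀; omega
  · have := cW_lt_blkW (n := n) (B' := B') hi₀ NB; unfold topZ at h; omega
  · have := cW_lt_blkW (n := n) (B' := B') hi₀ NB; unfold hiW topZ at h; omega

/-! ### Reading the strings off a basis label -/

/-- A basis label with the constants set: the low wires carry `1^{2n} 0 1 1`, the top zero wire
`0`, the high wires `1`. [folklore] -/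
structure ConstsSet (n B' NB : ℕ) (w : ℕ → Bool) : Prop where
  /-- the low constants -/
  lo : ∀ p, p ≤ 2 * n + 2 → w (loW n p) = loBit n p
  /-- the top zero -/
  top : w (topZ n B' NB) = false
  /-- the high ones -/
  hi : ∀ s, s ≤ B' → w (hiW n B' NB s) = true

/-- The `y`-register of block `β`, block length `j`, read off a label. [folklore] -/
def yOf (n B' : ℕ) (w : ℕ → Bool) (β j : ℕ) : List Bool := (List.range j).map fun t => w (pairW n B' β t 0)

/-- The length of the read-off register. [folklore] -/
@[simp] theorem length_yOf (w : ℕ → Bool) (β j : ℕ) : (yOf n B' w β j).length = j := by simp [yOf]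

/-- A range mapped through a function constantly `true` on it is a block of `1`s. [folklore] -/
theorem map_range_eq_replicate (k : ℕ) (f : ℕ → Bool) (h : ∀ s, s < k → f s = true) :
    (List.range k).map f = List.replicate k true := by
  apply List.ext_getElem (by simp)
  intro m hm _
  rw [List.getElem_map, List.getElem_range, List.getElem_replicate, h m (by simpa using hm)]

/-- The low constants read `1^{2n} 0 1 1`. [folklore] -/
theorem map_loW_range (w : ℕ → Bool) (h : ∀ p, p ≤ 2 * n + 2 → w (loW n p) = loBit n p) (k : ℕ) (hk : k ≤ 2 * n + 3) :
    (List.range k).map (fun p => w (loW n p)) = (List.range k).map (loBit n) :=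
  List.map_congr_left fun p hp => h p (by simp at hp; omega)

/-- `1^{2n} 0 1 1` as a mapped range. [folklore] -/
theorem map_loBit_range_three : (List.range (2 * n + 3)).map (loBit n) = List.replicate (2 * n) true ++ [false, true, true] := by
  rw [show 2 * n + 3 = 2 * n + 1 + 1 + 1 by ring, List.range_succ, List.range_succ, List.range_succ]
  simp only [List.map_append, List.map_cons, List.map_nil, List.append_assoc, List.cons_append, List.nil_append]
  rw [map_range_eq_replicate _ _ fun s hs => by unfold loBit; simp; omega]
  simp [loBit]

/-- `1^{2n} 0 1` as a mapped range. [folklore] -/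
theorem map_loBit_range_two : (List.range (2 * n + 2)).map (loBit n) = List.replicate (2 * n) true ++ [false, true] := by
  rw [show 2 * n + 2 = 2 * n + 1 + 1 by ring, List.range_succ, List.range_succ]
  simp only [List.map_append, List.map_cons, List.map_nil, List.append_assoc, List.cons_append, List.nil_append]
  rw [map_range_eq_replicate _ _ fun s hs => by unfold loBit; simp; omega]
  simp [loBit]

/-- An interleaved register whose odd entries copy the even ones is the doubling of its even part. [folklore] -/
theorem map_range_two_mul (j : ℕ) (g : ℕ → Bool) (h : ∀ t, t < j → g (2 * t + 1) = g (2 * t)) :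
    (List.range (2 * j)).map g = ((List.range j).map fun t => g (2 * t)).flatMap fun b => [b, b] := by
  induction j with
  | zero => rfl
  | succ j ih =>
    rw [show 2 * (j + 1) = 2 * j + 1 + 1 by ring, List.range_succ, List.range_succ, List.range_succ,
      List.map_append, List.map_append, List.map_append, List.flatMap_append, ih (fun t ht => h t (by omega))]
    simp [h j (by omega)]

/-- **The value-query wires read `qryStr n y i'`** off a label with the constants set and `y' = y`
on the block (`y = yOf w β j`). [cite: NielsenChuang2010, §6.1.1] -/
theorem map_qryWires {w : ℕ → Bool} (hw : ConstsSet n B' NB w) {β j i' : ℕ} (hi' : i' ≤ B')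
    (hcopy : ∀ t, t < j → w (pairW n B' β t 1) = w (pairW n B' β t 0)) :
    (qryWires n B' NB β j i').map w = qryStr n (yOf n B' w β j) i' := by
  have h1 : (List.range (2 * n + 3)).map (fun p => w (loW n p)) = List.replicate (2 * n) true ++ [false, true, true] := by
    rw [map_loW_range w hw.lo _ le_rfl, map_loBit_range_three]
  have h2 : (List.range (2 * j)).map (fun m => w (blkW n B' β + m)) = (yOf n B' w β j).flatMap fun b => [b, b] :=
    map_range_two_mul j _ fun t ht => hcopy t ht
  have h3 : (List.range i').map (fun s => w (hiW n B' NB (1 + s))) = List.replicate i' true :=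
    map_range_eq_replicate _ _ fun s hs => hw.hi _ (by omega)
  rw [qryStr_eq_bits, qryWires]
  simp only [List.map_append, List.map_map, List.map_cons, Function.comp_def, hw.top, hw.hi 0 (Nat.zero_le _),
    h1, h2, h3, List.append_assoc, List.cons_append, List.nil_append]

/-- **The announcement wires read `ancStr n i`** off a label with the constants set. [cite: NielsenChuang2010, §6.1.1] -/
theorem map_ancWires {w : ℕ → Bool} (hw : ConstsSet n B' NB w) {i : ℕ} (hi : i ≤ B') :
    (ancWires n B' NB i).map w = ancStr n i := by
  have h1 : (List.range (2 * n + 2)).map (fun p => w (loW n p)) = List.replicate (2 * n) true ++ [false, true] := by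
    rw [map_loW_range w hw.lo _ (by omega), map_loBit_range_two]
  have h3 : (List.range i).map (fun s => w (hiW n B' NB (1 + s))) = List.replicate i true :=
    map_range_eq_replicate _ _ fun s hs => hw.hi _ (by omega)
  rw [ancStr_eq_bits, ancWires]
  simp only [List.map_append, List.map_map, List.map_cons, Function.comp_def, hw.top, h1, h3,
    List.append_assoc, List.cons_append, List.nil_append]

end Wires

end SimonOracle

end Literature.Computability.QuantumComplexity
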